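import Literature.Analysis.FluidPDE.ClassicalSupStabilityBootstrap
import Literature.Analysis.FluidPDE.ClayForceLerayProjection
import HarnessLib

/-!
# Leray's `L^∞` window WITH A FORCE: a bounded classical solution with `‖u(0)‖_∞ ≤ A` stays below
# `2(A + T G)` for `t ≤ c ν / (A + T G)²`

Analysis/FluidPDE proof file (theorems only: no definition, no named fact, no `sorry`). Cell
`ns-blowup`, seat `ns-blowup-ecbridge-2` (g9, E–C endpoint theory). WHAT THIS IS NOT: not a statement
about Navier–Stokes blow-up — an a-priori sup-norm bound over an explicit window for a GIVEN
classical solution of the forced system on a closed slab; its consumer is Leray's `L^∞` blow-up rate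
WITH the Clay force on the (uninhabited) E–C type `ClayBlowup ν`.

**The window** (`leray_sup_window_forced`; Leray 1934, §19 (3.4)–(3.8) and §21 (3.15):
`V(t) ≤ (1 + A) V(0)` for `t − t₀ ≤ A ν³ σ / V(0)²`; Lemarié-Rieusset 2016, Thm. 6.1 (6.12); here with a
force). There is a universal `c > 0` such that: for `ν > 0`, `T > 0`, every classical solution
`(u, p)` of the Navier–Stokes system on `[0, T] × ℝ³` driven by a jointly continuous force `g`
(slices bounded by `G ≥ 0`, weakly divergence free, `‖g(τ)‖₂ ≤ G₂ < ∞` — e.g. the Leray projection of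
a Clay force), with finite energy, bounded by SOME `B` on the slab and with `‖u(0, ·)‖ ≤ A` (`A > 0`),
satisfies `‖u(t, x)‖ ≤ 2 (A + T G)` for all `x` and all `t ∈ [0, T]` with `(A + T G)² t ≤ c ν`.
The qualitative bound `B` does not enter the conclusion.

Mechanism (the continuity / bootstrap argument, Tao 2006, Prop. 1.21, run over a UNIFORM time step
as in the tree's `sup_stability_forced_free_bootstrap`): with `K = A + T G` and the tree's forced
short-time bound `exists_norm_le_sup_add_sqrt_add_force`
(`‖u(s)‖ ≤ A + C_B M² ν^{-1/2} 2√s + s G` on a slab where `‖u‖ ≤ M`): (i) IMPROVE — if `‖u‖ ≤ 2K` on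
`[0, s]` and `K² s ≤ c ν`, `c = 1/(256 C_B²)`, then `‖u‖ ≤ 3K/2` on `[0, s]`; (ii) ADVANCE — from a base
time `s` with `‖u(s)‖ ≤ 3K/2`, the short-time bound with the qualitative `B` keeps `‖u‖ ≤ 2K` on
`[s, s + δ]`, `δ = δ(ν, K, B, G) > 0` uniform; (iii) induction on `n` over `[0, nδ]`.

Also: `IsClassicalNSSolutionOn.to_clayProjForce_of_le` — the re-gauge `(u, p, f) ↦ (u, p − p_f, P f)`
on a SUB-slab `[0, s] ⊆ [0, T]` of the slab on which the projected force `P f` was built (the tree's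
`to_clayProjForce` is the case `s = T`).

## Mathlib / tree search

Tree (used): `exists_norm_le_sup_add_sqrt_add_force` (`ForcedOseenRepresentationClassical`),
`IsClassicalNSSolutionOn.comp_add_right` / `.mono` / `.add_gradient`, `clayProjForce`,
`clayProjForce_eq_sub_gradient_of_mem`, `isSmoothSpaceTimeOn_forcePressure_forceData`
(`ClayForceLerayProjection`, `ForcedFourierForcePressureData`). `lean search 'supnorm|sup_window|leray_sup'`:
`leray_supnorm_le_of_Lp_forced` (`NSForcedLeraySupNorm`, an `L^p`-datum window, `3 < p < ∞`) and the
unforced `LeraySupClock` (pub-fluidc); no `L^∞`-datum forced window existed.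

## References

* J. Leray, *Sur le mouvement d'un liquide visqueux emplissant l'espace*, Acta Math. 63 (1934),
  §19 (3.4)–(3.8), §21 (3.15). [Leray1934]
* P. G. Lemarié-Rieusset, *The Navier–Stokes Problem in the 21st Century*, CRC (2016), Thm. 6.1
  (6.12), Thm. 11.2. [LemarieRieusset2016]
* T. Tao, *Nonlinear Dispersive Equations*, CBMS 106 (2006), Prop. 1.21. [Tao2006Dispersive]
* T. Tao, Anal. PDE 6 (2013), (8) p. 3 (the Leray-projected force). [Tao2011]
-/

noncomputable section

open MeasureTheory Set Function Filter Complex FourierTransform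
open _root_.Topology
open scoped ENNReal NNReal FourierTransform

namespace Literature.Analysis.FluidPDE

open FourierNS

/-! ### §1 Re-gauging a Clay force to its Leray projection on a sub-slab -/

section Proj

variable {T : ℝ} {f : ℝ → EuclideanSpace ℝ (Fin 3) → EuclideanSpace ℝ (Fin 3)}
  (hT : 0 < T) (hf : IsSmoothSpaceTimeOn (Icc 0 T) f) (hd : HasUniformRapidDecayOn (Icc 0 T) f)

/-- **The re-gauge `(u, p, f) ↦ (u, p − p_f, P f)` on a sub-slab** `[0, s] ⊆ [0, T]`: a classical
solution driven by the raw force `f` on `[0, s] × ℝ³` is a classical solution driven by the PROJECTED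
force `P f` (built on `[0, T]`) with the pressure `p − Δ⁻¹∇·f` (the momentum equation only sees
`−∇p + f`; Tao 2013, (8)). The case `s = T` is the tree's `to_clayProjForce`. [cite: Tao2011, (8) p. 3] -/
theorem IsClassicalNSSolutionOn.to_clayProjForce_of_le {ν s : ℝ} (hsT : s ≤ T)
    {u : ℝ → EuclideanSpace ℝ (Fin 3) → EuclideanSpace ℝ (Fin 3)}
    {p : ℝ → EuclideanSpace ℝ (Fin 3) → ℝ} (h : IsClassicalNSSolutionOn (Icc 0 s) ν f u p) :
    IsClassicalNSSolutionOn (Icc 0 s) ν (clayProjForce hT hf hd) u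
      (fun t x => p t x + (-1 : ℝ) • (𝓕 (forcePresSymbol (forceData hT hf hd t)) x).re) := by
  have hsub : Icc 0 s ⊆ Icc 0 T := Icc_subset_Icc le_rfl hsT
  have hps : IsSmoothSpaceTimeOn (Icc 0 s)
      (fun t x => (𝓕 (forcePresSymbol (forceData hT hf hd t)) x).re) :=
    (isSmoothSpaceTimeOn_forcePressure_forceData hT hf hd).mono hsub
  refine h.add_gradient (hps.const_smul (-1)) fun t ht x => ?_
  have hd1 : DifferentiableAt ℝ (fun y => (𝓕 (forcePresSymbol (forceData hT hf hd t)) y).re) x :=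
    ((hps.contDiff_slice ht).differentiable (by simp)).differentiableAt
  have hneg : gradient (fun y => (-1 : ℝ) • (𝓕 (forcePresSymbol (forceData hT hf hd t)) y).re) x =
      -gradient (fun y => (𝓕 (forcePresSymbol (forceData hT hf hd t)) y).re) x := by
    have hfun : (fun y => (-1 : ℝ) • (𝓕 (forcePresSymbol (forceData hT hf hd t)) y).re) =
        (-1 : ℝ) • fun y => (𝓕 (forcePresSymbol (forceData hT hf hd t)) y).re := rfl
    rw [gradient, gradient, hfun, fderiv_const_smul hd1 (-1 : ℝ), map_smul, neg_one_smul]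
  rw [hneg, clayProjForce_eq_sub_gradient_of_mem hT hf hd (hsub ht)]
  abel

end Proj

/-! ### §2 The forced `L^∞` window -/

set_option maxHeartbeats 800000 in
/-- **Leray's `L^∞` window WITH A FORCE** (Leray 1934, §19 (3.4)–(3.8), §21 (3.15); Lemarié-Rieusset
2016, Thm. 6.1 (6.12)). There is a universal `c > 0` such that for every `ν > 0`, `T > 0`, every
classical solution `(u, p)` of the Navier–Stokes system on `[0, T] × ℝ³` driven by a jointly continuous
force `g` with `‖g‖ ≤ G` (`G ≥ 0`), weakly divergence-free slices and `‖g(τ)‖₂ ≤ G₂ < ∞`, with finite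
energy, `‖u‖ ≤ B` on the slab for SOME `B`, and `‖u(0, ·)‖ ≤ A` (`A > 0`): for all `t ∈ [0, T]` with
`(A + T G)² t ≤ c ν` and all `x`, `‖u(t, x)‖ ≤ 2 (A + T G)`. Bootstrap over a uniform time step with
the tree's forced short-time bound `exists_norm_le_sup_add_sqrt_add_force`; `c = 1/(256 C_B²)`.
[cite: Leray1934, §19 (3.4)–(3.8), §21 (3.15)] [cite: LemarieRieusset2016, Thm. 6.1 (6.12)]
[cite: Tao2006Dispersive, Prop. 1.21] -/
theorem leray_sup_window_forced :
    ∃ c : ℝ, 0 < c ∧ ∀ {ν T G A B : ℝ}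
      {g u : ℝ → EuclideanSpace ℝ (Fin 3) → EuclideanSpace ℝ (Fin 3)}
      {p : ℝ → EuclideanSpace ℝ (Fin 3) → ℝ} {G₂ : ℝ≥0∞},
      0 < ν → 0 < T →
      IsClassicalNSSolutionOn (Icc 0 T) ν g u p → Continuous (uncurry g) →
      0 ≤ G → (∀ τ ∈ Icc 0 T, ∀ y, ‖g τ y‖ ≤ G) → (∀ τ ∈ Icc 0 T, IsWeaklyDivFree (g τ)) →
      G₂ ≠ ⊤ → (∀ τ ∈ Icc 0 T, eLpNorm (g τ) 2 volume ≤ G₂) →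
      (∃ C : ℝ≥0∞, C < ⊤ ∧ ∀ t ∈ Icc 0 T, ∫⁻ x, ‖u t x‖ₑ ^ 2 ≤ C) →
      (∀ s ∈ Icc 0 T, ∀ y, ‖u s y‖ ≤ B) → 0 < A → (∀ y, ‖u 0 y‖ ≤ A) →
      ∀ t ∈ Icc 0 T, (A + T * G) ^ 2 * t ≤ c * ν → ∀ x, ‖u t x‖ ≤ 2 * (A + T * G) := by
  obtain ⟨CB, hCB, hmin⟩ := exists_norm_le_sup_add_sqrt_add_force
  refine ⟨1 / (256 * CB ^ 2), by positivity, ?_⟩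
  intro ν T G A B g u p G₂ hν hT hcl hgc hG0 hG hgdiv hG₂ hg2 hE hbd hA0 hA
  -- ### constants
  set K : ℝ := A + T * G with hKdef
  have hK0 : 0 < K := by positivity
  have hAK : A ≤ K := le_add_of_nonneg_right (by positivity)
  -- the qualitative bound, made ≥ 2K
  set B₁ : ℝ := max B (2 * K) with hB₁
  have hB₁pos : 0 < B₁ := lt_of_lt_of_le (by positivity) (le_max_right _ _)
  have hbd₁ : ∀ t ∈ Icc 0 T, ∀ y, ‖u t y‖ ≤ B₁ := fun t ht y => (hbd t ht y).trans (le_max_left _ _)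
  have hsν : 0 < Real.sqrt ν := Real.sqrt_pos.2 hν
  have hν12 : ν ^ (-(1 / 2 : ℝ)) = (Real.sqrt ν)⁻¹ := by
    rw [Real.rpow_neg hν.le, Real.sqrt_eq_rpow]
  -- ### (i) IMPROVE: `‖u‖ ≤ 2K` on `[0, s]` with `K² s ≤ c ν` gives `‖u‖ ≤ 3K/2` on `[0, s]`
  have improve : ∀ s : ℝ, 0 < s → s ≤ T → (A + T * G) ^ 2 * s ≤ 1 / (256 * CB ^ 2) * ν →
      (∀ τ ∈ Icc 0 s, ∀ y, ‖u τ y‖ ≤ 2 * K) → ∀ τ ∈ Icc 0 s, ∀ y, ‖u τ y‖ ≤ 3 / 2 * K := by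
    intro s hs0 hsT hsc hbs τ hτ y
    rcases hτ.1.eq_or_lt with h0 | hτ0
    · rw [← h0]; linarith [hA y]
    have hsub : Icc 0 s ⊆ Icc 0 T := Icc_subset_Icc le_rfl hsT
    have hcls : IsClassicalNSSolutionOn (Icc 0 s) ν g u p := hcl.mono hsub (uniqueDiffOn_Icc hs0)
    have hEs : ∃ C : ℝ≥0∞, C < ⊤ ∧ ∀ t ∈ Icc 0 s, ∫⁻ x, ‖u t x‖ₑ ^ 2 ≤ C := by
      obtain ⟨C, hC, hb⟩ := hE; exact ⟨C, hC, fun t ht => hb t (hsub ht)⟩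
    have key := hmin hν hs0 hcls hgc (fun τ hτ => hG τ (hsub hτ)) (fun τ hτ => hgdiv τ (hsub hτ)) hG₂
      (fun τ hτ => hg2 τ (hsub hτ)) hEs (by positivity : 0 < 2 * K) hbs hA τ ⟨hτ0, hτ.2⟩ y
    -- `√τ ≤ √s ≤ √ν / (16 C_B K)`
    have hKs : K ^ 2 * s ≤ ν / (256 * CB ^ 2) := by
      rw [hKdef]; rw [div_eq_mul_one_div, mul_comm ν]; exact hsc
    have hsq : Real.sqrt τ ≤ Real.sqrt ν / (16 * CB * K) := by
      have h1 : τ ≤ ν / (16 * CB * K) ^ 2 := by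
        rw [le_div_iff₀ (by positivity)]
        calc τ * (16 * CB * K) ^ 2 = 256 * CB ^ 2 * (K ^ 2 * τ) := by ring
          _ ≤ 256 * CB ^ 2 * (K ^ 2 * s) := by gcongr; exact hτ.2
          _ ≤ 256 * CB ^ 2 * (ν / (256 * CB ^ 2)) := by gcongr
          _ = ν := by field_simp
      rw [← Real.sqrt_sq (by positivity : (0 : ℝ) ≤ 16 * CB * K), ← Real.sqrt_div' _ (sq_nonneg _)]
      exact Real.sqrt_le_sqrt h1
    have hmid : CB * (2 * K) ^ 2 * ν ^ (-(1 / 2 : ℝ)) * (2 * Real.sqrt τ) ≤ K / 2 := by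
      rw [hν12]
      calc CB * (2 * K) ^ 2 * (Real.sqrt ν)⁻¹ * (2 * Real.sqrt τ)
          ≤ CB * (2 * K) ^ 2 * (Real.sqrt ν)⁻¹ * (2 * (Real.sqrt ν / (16 * CB * K))) := by gcongr
        _ = K / 2 := by field_simp; ring
    have hτG : τ * G ≤ T * G := mul_le_mul_of_nonneg_right (hτ.2.trans hsT) hG0
    rw [hKdef] at hmid ⊢
    linarith [key, hmid, hτG]
  -- ### (ii) ADVANCE: the uniform step from a base time with `‖u(s)‖ ≤ 3K/2`
  set δ : ℝ := min (ν * (K / (8 * CB * B₁ ^ 2)) ^ 2) (K / (4 * (G + 1))) with hδ_def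
  have hδpos : 0 < δ := lt_min (by positivity) (by positivity)
  have hstep : ∀ τ : ℝ, 0 < τ → τ ≤ δ →
      CB * B₁ ^ 2 * ν ^ (-(1 / 2 : ℝ)) * (2 * Real.sqrt τ) ≤ K / 4 ∧ τ * G ≤ K / 4 := by
    intro τ hτ0 hτδ
    constructor
    · have hτ1 : τ ≤ ν * (K / (8 * CB * B₁ ^ 2)) ^ 2 := hτδ.trans (min_le_left _ _)
      have hsq : Real.sqrt τ ≤ Real.sqrt ν * (K / (8 * CB * B₁ ^ 2)) := by
        rw [← Real.sqrt_sq (by positivity : (0 : ℝ) ≤ K / (8 * CB * B₁ ^ 2)), ← Real.sqrt_mul hν.le]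
        exact Real.sqrt_le_sqrt hτ1
      rw [hν12]
      calc CB * B₁ ^ 2 * (Real.sqrt ν)⁻¹ * (2 * Real.sqrt τ)
          ≤ CB * B₁ ^ 2 * (Real.sqrt ν)⁻¹ * (2 * (Real.sqrt ν * (K / (8 * CB * B₁ ^ 2)))) := by
            gcongr
        _ = K / 4 := by field_simp; ring
    · have hτ2 : τ ≤ K / (4 * (G + 1)) := hτδ.trans (min_le_right _ _)
      calc τ * G ≤ K / (4 * (G + 1)) * G := mul_le_mul_of_nonneg_right hτ2 hG0
        _ ≤ K / 4 := by
            rw [div_mul_eq_mul_div, div_le_iff₀ (by positivity)]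
            nlinarith
  have advance : ∀ s : ℝ, 0 ≤ s → s < T → (∀ y, ‖u s y‖ ≤ 3 / 2 * K) →
      ∀ t ∈ Icc s T, t - s ≤ δ → ∀ x, ‖u t x‖ ≤ 2 * K := by
    intro s hs0 hsT hbase t ht htδ x
    rcases ht.1.eq_or_lt with heq | hst
    · rw [← heq]; linarith [hbase x]
    have hTs : 0 < T - s := by linarith
    have hcl'' : IsClassicalNSSolutionOn (Icc 0 (T - s)) ν (fun τ => g (τ + s))
        (fun τ => u (τ + s)) (fun τ => p (τ + s)) :=
      (hcl.comp_add_right s).mono (fun τ hτ => ⟨by linarith [hτ.1], by linarith [hτ.2]⟩)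
        (uniqueDiffOn_Icc hTs)
    have hg''c : Continuous (uncurry fun τ => g (τ + s)) :=
      hgc.comp ((continuous_fst.add continuous_const).prodMk continuous_snd)
    have hG'' : ∀ τ ∈ Icc 0 (T - s), ∀ y, ‖(fun τ => g (τ + s)) τ y‖ ≤ G := fun τ hτ y =>
      hG (τ + s) ⟨by linarith [hτ.1], by linarith [hτ.2]⟩ y
    have hg''div : ∀ τ ∈ Icc 0 (T - s), IsWeaklyDivFree ((fun τ => g (τ + s)) τ) := fun τ hτ =>
      hgdiv (τ + s) ⟨by linarith [hτ.1], by linarith [hτ.2]⟩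
    have hg''2 : ∀ τ ∈ Icc 0 (T - s), eLpNorm ((fun τ => g (τ + s)) τ) 2 volume ≤ G₂ :=
      fun τ hτ => hg2 (τ + s) ⟨by linarith [hτ.1], by linarith [hτ.2]⟩
    have hE'' : ∃ C : ℝ≥0∞, C < ⊤ ∧ ∀ τ ∈ Icc 0 (T - s), ∫⁻ x, ‖(fun τ => u (τ + s)) τ x‖ₑ ^ 2 ≤ C := by
      obtain ⟨C, hC, hb⟩ := hE
      exact ⟨C, hC, fun τ hτ => hb (τ + s) ⟨by linarith [hτ.1], by linarith [hτ.2]⟩⟩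
    have hbd'' : ∀ τ ∈ Icc 0 (T - s), ∀ y, ‖(fun τ => u (τ + s)) τ y‖ ≤ B₁ := fun τ hτ y =>
      hbd₁ (τ + s) ⟨by linarith [hτ.1], by linarith [hτ.2]⟩ y
    have hA' : ∀ y, ‖(fun τ => u (τ + s)) 0 y‖ ≤ 3 / 2 * K := fun y => by
      simpa using hbase y
    have hτI : t - s ∈ Ioc 0 (T - s) := ⟨by linarith, by linarith [ht.2]⟩
    have key := hmin hν hTs hcl'' hg''c hG'' hg''div hG₂ hg''2 hE'' hB₁pos hbd'' hA' (t - s) hτI x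
    have hts : t - s + s = t := by ring
    simp only [hts] at key
    obtain ⟨h1, h2⟩ := hstep (t - s) (by linarith) htδ
    linarith
  -- ### (iii) the induction over the uniform step, inside the window
  have induct : ∀ n : ℕ, ∀ t ∈ Icc 0 T, t ≤ (n : ℝ) * δ →
      (A + T * G) ^ 2 * t ≤ 1 / (256 * CB ^ 2) * ν → ∀ y, ‖u t y‖ ≤ 2 * K := by
    intro n
    induction n with
    | zero =>
      intro t ht htn _ y
      have ht0 : t = 0 := le_antisymm (by simpa using htn) ht.1
      rw [ht0]
      linarith [hA y]
    | succ n ih =>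
      intro t ht htn htc y
      -- the base time of this step
      set s : ℝ := min ((n : ℝ) * δ) t with hs_def
      have hs0 : 0 ≤ s := le_min (by positivity) ht.1
      have hst : s ≤ t := min_le_right _ _
      have hsT : s ≤ T := hst.trans ht.2
      have hsc : (A + T * G) ^ 2 * s ≤ 1 / (256 * CB ^ 2) * ν :=
        (mul_le_mul_of_nonneg_left hst (sq_nonneg _)).trans htc
      -- `‖u‖ ≤ 2K` on `[0, s]` by the induction hypothesis
      have hbs : ∀ τ ∈ Icc 0 s, ∀ z, ‖u τ z‖ ≤ 2 * K := fun τ hτ z =>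
        ih τ ⟨hτ.1, hτ.2.trans hsT⟩ (hτ.2.trans (min_le_left _ _))
          ((mul_le_mul_of_nonneg_left (hτ.2.trans hst) (sq_nonneg _)).trans htc) z
      -- hence `‖u(s)‖ ≤ 3K/2`
      have hbase : ∀ z, ‖u s z‖ ≤ 3 / 2 * K := by
        intro z
        rcases hs0.eq_or_lt with hs00 | hspos
        · rw [← hs00]; linarith [hA z]
        · exact improve s hspos hsT hsc hbs s ⟨hs0, le_rfl⟩ z
      -- the step from `s` to `t`
      have htsδ : t - s ≤ δ := by
        rcases le_total ((n : ℝ) * δ) t with h | h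
        · have : s = (n : ℝ) * δ := min_eq_left h
          push_cast at htn
          rw [this]; linarith
        · have : s = t := min_eq_right h
          rw [this, sub_self]; exact hδpos.le
      rcases hsT.eq_or_lt with hsTeq | hsltT
      · -- `s = T` forces `t = T = s`
        have hts : t = s := le_antisymm (hsTeq ▸ ht.2) hst
        rw [hts]
        exact hbs s ⟨hs0, le_rfl⟩ y
      exact advance s hs0 hsltT hbase t ⟨hst, ht.2⟩ htsδ y
  -- ### conclusion
  obtain ⟨n, hn⟩ := exists_nat_ge (T / δ)
  intro t ht htc x
  refine induct n t ht ?_ htc x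
  have : T ≤ (n : ℝ) * δ := by rwa [div_le_iff₀ hδpos] at hn
  exact ht.2.trans this

end Literature.Analysis.FluidPDE

end
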